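import Mathlib
import HarnessLib
import Summits.ValiantsHypothesis.ValiantsHypothesis.Theses.MonotoneRestoration
import Literature.Computability.AlgebraicComplexity.ArithCircuit
import Literature.Computability.AlgebraicComplexity.ArithCircuitProofs
import Literature.Computability.AlgebraicComplexity.MonotoneStructure
import Literature.Computability.AlgebraicComplexity.PermanentIrreducible
import Literature.ModelTheory.FiniteModelTheory.CkEquiv
import Summits.ValiantsHypothesis.ValiantsHypothesis.Theorems.MonotoneRestorationMonotoneRestorationQPCosetCount
import Summits.ValiantsHypothesis.ValiantsHypothesis.Theorems.MonotoneRestorationMonotoneRestorationQPSymmetricLB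
import Summits.ValiantsHypothesis.ValiantsHypothesis.Theorems.MonotoneRestorationMonotoneRestorationQPSupportSymmetrisation
import Summits.ValiantsHypothesis.ValiantsHypothesis.Theorems.MonotoneRestorationMonotoneRestorationQPSparseRegime
import Summits.ValiantsHypothesis.ValiantsHypothesis.Theorems.MonotoneRestorationMonotoneRestorationQPBeta
import Literature.Computability.AlgebraicComplexity.SymmetricArithCircuit
import Literature.Computability.AlgebraicComplexity.DawarWilsenach2025Proofs
import Literature.GroupTheory.PermutationGroups.SmallIndexSubgroups
import Summits.ValiantsHypothesis.ValiantsHypothesis.Theorems.MonotoneRestorationQP.Negative.LoadBearing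
import Summits.ValiantsHypothesis.ValiantsHypothesis.Theorems.MonotoneRestorationMonotoneRestorationQPPermSupportCount

/-! TTRL-lite variant V20090 of stmt-ValiantsHypothesis-15886

Target `stub_gateSupport`, move `lemma_proposal`: constant gates have EMPTY support,
unconditionally (no size bound, no parity, no `n > 8`). In a `Sym_n`-symmetric labelled
arithmetic circuit, every `ρ` extends to some automorphism `π` (symmetry, Def. 3.7), and every
automorphism fixes every constant gate (`IsAutomorphismExtending.apply_eq_self_of_label_const`,
Def. 3.6: labels are injective on input gates). Second base case of the support theorem.
-/

-- `Summit.ValiantsHypothesis.ValiantsHypothesis.…` is the tree's mandated single-conjunct layout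
-- (Sub = Summit), so the duplicated namespace component is intended.
set_option linter.dupNamespace false

namespace Summit.ValiantsHypothesis.ValiantsHypothesis.Theorems

open Summit.ValiantsHypothesis.ValiantsHypothesis.Theses.MonotoneRestoration
open Literature.Computability.AlgebraicComplexity

/-- **TTRL-lite variant V20090 of `stub_gateSupport`** (constant gates have empty support).
In a `Sym_n`-symmetric labelled arithmetic circuit `C` on the variables `Fin n × Fin n`, for every
constant gate `g` (`C.label g = const c`) and every permutation `ρ`, there is a circuit automorphism
`π` extending `ρ` with `π g = g`: symmetry supplies an extension `π` of `ρ`, and any automorphism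
fixes a constant gate because its label is unique.
[cite: DawarWilsenach2025, Def. 3.6 (first bullet), Def. 3.7] -/
theorem stub_gateSupport_var20090 :
    ∀ (n : ℕ) (K : Type) (G : Type) (C : LabelledArithCircuit K (Fin n × Fin n) Unit G)
      (hC : C.IsSymmetric (Equiv.Perm (Fin n))) (g : G) (c : K) (ρ : Equiv.Perm (Fin n)),
      C.label g = CircuitLabel.const c →
        ∃ π : Equiv.Perm G, C.IsAutomorphismExtending ρ π ∧ π g = g := by
  intro n K G C hC g c ρ hg
  obtain ⟨π, hπ⟩ := hC ρ
  exact ⟨π, hπ, hπ.apply_eq_self_of_label_const hg⟩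

end Summit.ValiantsHypothesis.ValiantsHypothesis.Theorems
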